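import Literature.MathematicalPhysics.QuantumLattice.TorusSectorGibbsEnergyWindow
import Literature.MathematicalPhysics.QuantumLattice.HubbardTTPrimeScaleHomogeneity
import Literature.MathematicalPhysics.QuantumLattice.GibbsTwoTimeBound
import Literature.MathematicalPhysics.QuantumLattice.GibbsSectorWeightTransfer
import HarnessLib

/-!
# Scale covariance of the torus-limit thermal convention: the canonical sector Gibbs states of the
# `t–t'` Hubbard model `H(ct, ct', cU)` at inverse temperature `β` are those of `H(t, t', U)` at `βc`

Topic `MathematicalPhysics/QuantumLattice` (family `hubbard`); companion of `TorusSectorGibbsMixture` /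
`TorusSectorGibbsEnergyWindow` (the `T > 0` word shape of record of the Hubbard certificate layer: torus
limits `ω` of the canonical Gibbs states `ρ_{L,β} = e^{-βH_L}/Z` on the sector `(rectN n L, S^z = 0)`,
`IsTorusLimitOfMixture (sectorGibbsCount n) (sectorGibbsWeightTT' β t t' U n) (sectorGibbsVectorTT' t t' U n) Ls`)
and of `HubbardTTPrimeScaleHomogeneity` §4 (Gibbs state of `c • H` at `β` = Gibbs state of `H` at `βc`).
Written for the material-oracle pipeline (downfolded box = unit couplings `(t'/t, U/t, n)` PLUS a scale
`t_eV ∈ [t₁, t₂]`; every certified word is produced at `t = 1`; the temperature axis of a phase map is in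
kelvin): it proves that the thermal convention itself is scale-covariant, so that a `T > 0` word certified
for the unit model at `β̃` IS a word for the physical model at `β = β̃/t`.

* §1 THE MIXTURE IS THE GIBBS STATE OF THE COMPRESSION, ON EVERY OBSERVABLE (basis-free form). The
  components `ψ_{L,i}` of `TorusSectorGibbsMixture` are Mathlib's eigenbasis of the compression
  `H_L|_sector` — a CHOICE, which is not covariant under `H ↦ c • H`; the state is. For every matrix `B`:
  `Σ_a w_a ⟨ψ_a, B ψ_a⟩ = tr(e^{-βA|_p} B|_p) / tr e^{-βA|_p}`
  (`sum_canonicalWeight_mul_expect_sectorEigenvector_eq_gibbsState`, abstract coordinate sector;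
  `sum_sectorGibbsWeightTT'_mul_expect_eq_gibbsState`, the `t–t'` torus: `= gibbsState β (sectorHamiltonianTT' …) B|_s`;
  for `B = H_L` this is the tree's `re_gibbsState_sectorHamiltonianTT'`).
* §2 FINITE VOLUME: `H_L(ct,ct',cU)|_s = c • H_L(t,t',U)|_s` (`sectorHamiltonianTT'_scale`), hence
  `Z_β(cΦ) = Z_{βc}(Φ)` (`partitionFn_sectorHamiltonianTT'_scale`), the sector Gibbs state
  (`gibbsState_sectorHamiltonianTT'_scale`) and — by §1 — the Gibbs MIXTURE on every torus operator and
  every translation-averaged local observable (`sum_sectorGibbsWeightTT'_mul_expect_scale`,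
  `sum_sectorGibbsWeightTT'_mul_torusAvgExpect_scale`) of `(ct, ct', cU)` at `β` equal those of
  `(t, t', U)` at `βc` (ANY real `c`).
* §3 THERMODYNAMIC LIMIT: the class of thermal torus limits is scale-covariant —
  `IsTorusLimitOfMixture … (β; ct, ct', cU) … ↔ IsTorusLimitOfMixture … (βc; t, t', U) …`
  (`InfVolFermionState.isTorusLimitOfMixture_sectorGibbs_scale_iff`) and the unit form
  `(β; t, t', U) ↔ (βt; 1, t'/t, U/t)` for `t ≠ 0` (`…_iff_unit`): **the dimensionless rescaling lemma at
  `T > 0`** in the convention of record — thermal words depend on `(U/t, t'/t, n, k_B T/t)` only, the kelvin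
  axis carries one power of `t_eV`; free-energy rows likewise (`partitionFn_sectorHamiltonianTT'_phys_eq_unit`).

The consequences for BOX → WORD transport (unit word on a `β̃`-interval ⇒ physical word on a scale box;
thermal energy windows on a filling box) are in the companion `TorusSectorGibbsScaleBoxWords`.
HONEST LIMITS: exact covariance only — nothing here bounds the temperature dependence of any word.
Everything is PROVED; no definition, no named fact, no sorry.

## Tree search (cited, not restated)

`sectorExtend`, `sectorEigenvector`, `sectorEigenvalue`, `canonicalWeight`, `sectorGibbs{Count,Index,EnergyTT',VectorTT',WeightTT'}`
(`TorusSectorGibbsMixture`), `sectorHamiltonianTT'`, `re_gibbsState_sectorHamiltonianTT'` (`TorusSectorGibbsEnergyWindow`),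
`InfVolFermionState.IsTorusLimitOfMixture`, `torusAvgExpect(_eq,_zero)`, `torusAvgExpectAt_of_(not_)injOn`
(`TorusLimitOfMixtures`, `InfVolFermionState`), `hubbardTorusTT'_smul`, `Matrix.partitionFn_real_smul`,
`Matrix.gibbsState_real_smul` (`HubbardTTPrimeScaleHomogeneity`), `partitionFn_eq_sum_exp` (`FinDimSpectrum`),
`trace_gibbsWeight_mul_eq_sum` (`GibbsTwoTimeBound`), `star_mul_mul_apply_self_eq_star_dotProduct_mulVec`
(`GibbsSectorWeightTransfer`). `lean search 'scale_iff|real_smul' ∩ 'sectorGibbs|IsTorusLimitOfMixture'`: nothing.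

## References

* D. Ruelle, *Statistical Mechanics: Rigorous Results* (1969), §3.3 (thermodynamic functions are positively
  homogeneous in the interaction). [cite: Ruelle1969, §3.3]
* R. B. Israel, *Convexity in the Theory of Lattice Gases* (1979), §I.3 eq. (26) (the periodic-boundary
  condition Gibbs state `tr(e^{-βH} ·)/tr e^{-βH}` of a quantum lattice system on the torus).
  [cite: Israel1979, §I.3 eq. (26)]
* O. Bratteli, D. W. Robinson, *Operator Algebras and Quantum Statistical Mechanics I*, 2nd ed. (1987),
  §4.3.1 (group-averaged states and their weak-⋆ limit points). [cite: BratteliRobinsonI1987, §4.3.1 (PDF pp. 373–375)]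
* H. Xu et al., Science 384 (2024) eadh7691, eq. (1) (the `t–t'` Hubbard Hamiltonian, energies in units
  of `t`). [cite: XuEtAl2024, eq. (1)]
-/

noncomputable section

namespace Literature.MathematicalPhysics.QuantumLattice

open Matrix Finset HubbardWave0 Literature.Probability.LatticeModels ThermodynamicLimit
open _root_.Filter
open scoped _root_.Topology ComplexOrder BigOperators

/-! ### §1 The canonical eigen-mixture of a compression IS the Gibbs state of the compression -/

section CoordinateSector

variable {ι : Type*} [Fintype ι] [DecidableEq ι] (p : ι → Prop) [DecidablePred p]

omit [DecidableEq ι] in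
/-- A sum of a function vanishing off `p` is the sum over `Subtype p`. [folklore] -/
private theorem sum_eq_sum_subtype_of_eq_zero_off' (f : ι → ℂ) (hf : ∀ i, ¬ p i → f i = 0) :
    ∑ i, f i = ∑ a : Subtype p, f a.1 := by
  rw [← Finset.sum_subtype (Finset.univ.filter p) (by simp), Finset.sum_filter_of_ne]
  intro i _ hi
  by_contra h
  exact hi (hf i h)

omit [DecidableEq ι] in
/-- **The quadratic form of ANY matrix in a vector extended by zero from the sector is the quadratic
form of its compression**: `⟨ext φ, B ext φ⟩ = ⟨φ, B|_p φ⟩`, `B|_p = B.submatrix val val` (no invariance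
of the sector under `B` is needed). [folklore] -/
private theorem star_sectorExtend_dotProduct_mulVec_eq_submatrix (B : Matrix ι ι ℂ) (φ : Subtype p → ℂ) :
    star (sectorExtend p φ) ⬝ᵥ (B *ᵥ sectorExtend p φ) =
      star φ ⬝ᵥ (B.submatrix (Subtype.val : Subtype p → ι) Subtype.val *ᵥ φ) := by
  have hval : ∀ a : Subtype p, sectorExtend p φ a.1 = φ a := fun a => by
    simp [sectorExtend, a.2]
  have hoff : ∀ i, ¬ p i → sectorExtend p φ i = 0 := fun i hi => by simp [sectorExtend, hi]
  rw [dotProduct, sum_eq_sum_subtype_of_eq_zero_off' p]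
  · rw [dotProduct]
    refine Finset.sum_congr rfl fun a _ => ?_
    rw [Pi.star_apply, Pi.star_apply, hval, mulVec, mulVec, dotProduct, dotProduct,
      sum_eq_sum_subtype_of_eq_zero_off' p]
    · refine congrArg _ (Finset.sum_congr rfl fun b _ => ?_)
      rw [hval, submatrix_apply]
    · intro j hj
      rw [hoff j hj, mul_zero]
  · intro i hi
    rw [Pi.star_apply, hoff i hi, star_zero, zero_mul]

/-- **The canonical eigen-mixture of a compression is the Gibbs state of the compression, on EVERY
observable** (basis-free form of the mixture). For a Hermitian `A`, a coordinate sector `p`, the sector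
eigenvectors `ψ_a` / eigenvalues `E_a` of `TorusSectorGibbsMixture` (Mathlib's eigenbasis of the compression
`A|_p`, extended by zero) and the Boltzmann weights `w_a = e^{−βE_a}/Σ_b e^{−βE_b}`:
`Σ_a w_a ⟨ψ_a, B ψ_a⟩ = tr(e^{−βA|_p} B|_p)/tr(e^{−βA|_p}) = gibbsState β A|_p B|_p` for every matrix
`B` — so every statement about the mixture is a statement about the (choice-free) Gibbs state of the
compression. [cite: Israel1979, §I.3 eq. (26)] -/
theorem sum_canonicalWeight_mul_expect_sectorEigenvector_eq_gibbsState (A : Matrix ι ι ℂ)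
    (hA : A.IsHermitian) (β : ℝ) (B : Matrix ι ι ℂ) :
    ∑ a : Subtype p, (canonicalWeight β (sectorEigenvalue p A hA) a : ℂ) *
        (star (sectorEigenvector p A hA a) ⬝ᵥ (B *ᵥ sectorEigenvector p A hA a)) =
      gibbsState β (A.submatrix (Subtype.val : Subtype p → ι) Subtype.val)
        (B.submatrix (Subtype.val : Subtype p → ι) Subtype.val) := by
  set K : Matrix (Subtype p) (Subtype p) ℂ := A.submatrix (Subtype.val : Subtype p → ι) Subtype.val
    with hK_def
  set Bp : Matrix (Subtype p) (Subtype p) ℂ := B.submatrix (Subtype.val : Subtype p → ι) Subtype.val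
    with hBp_def
  have hK : K.IsHermitian := hA.submatrix Subtype.val
  -- the mixture data in terms of the compression `K`
  have hvec : ∀ a, sectorEigenvector p A hA a =
      sectorExtend p (fun b => (hK.eigenvectorUnitary : Matrix (Subtype p) (Subtype p) ℂ) b a) :=
    fun a => rfl
  have hval : ∀ a, sectorEigenvalue p A hA a = hK.eigenvalues a := fun a => rfl
  have hq : ∀ a, star (sectorEigenvector p A hA a) ⬝ᵥ (B *ᵥ sectorEigenvector p A hA a) =
      (star (hK.eigenvectorUnitary : Matrix (Subtype p) (Subtype p) ℂ) * Bp *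
        (hK.eigenvectorUnitary : Matrix (Subtype p) (Subtype p) ℂ)) a a := by
    intro a
    rw [hvec, star_sectorExtend_dotProduct_mulVec_eq_submatrix,
      star_mul_mul_apply_self_eq_star_dotProduct_mulVec]
  simp_rw [hq, canonicalWeight, hval]
  rw [gibbsState_apply, partitionFn_eq_sum_exp β hK, trace_gibbsWeight_mul_eq_sum hK β Bp,
    Finset.mul_sum]
  refine Finset.sum_congr rfl fun a _ => ?_
  push_cast
  simp only [neg_mul]
  ring

end CoordinateSector

/-! ### §1b The canonical sector Gibbs state of the `t–t'` torus -/

/-- **The canonical sector Gibbs mixture of the `t–t'` torus is the Gibbs state of the sector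
Hamiltonian, on every torus operator**: `Σ_i p_{L,i}(β) ⟨ψ_{L,i}, B ψ_{L,i}⟩ = ⟨B|_sector⟩_{β, H_L|_sector}`
(`sectorHamiltonianTT' = H_L|_{(rectN n L, S^z = 0)}`; `B` arbitrary — for `B = H_L` this is
`re_gibbsState_sectorHamiltonianTT'`). The right-hand side does not involve the (non-canonical) choice
of eigenbasis inside `sectorGibbsVectorTT'`. [cite: Israel1979, §I.3 eq. (26)] -/
theorem sum_sectorGibbsWeightTT'_mul_expect_eq_gibbsState (β t t' U n : ℝ) (L : ℕ)
    (B : Matrix (Finset (Orb (FermionTorus 2 L))) (Finset (Orb (FermionTorus 2 L))) ℂ) :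
    ∑ i, (sectorGibbsWeightTT' β t t' U n L i : ℂ) * expect B (sectorGibbsVectorTT' t t' U n L i) =
      gibbsState β (sectorHamiltonianTT' t t' U n L) (B.submatrix Subtype.val Subtype.val) := by
  set e := sectorGibbsIndex n L with he
  set E := sectorEigenvalue (szConfig n L) (hubbardTorusTT' L t t' U) (hubbardTorusTT'_isHermitian L t t' U)
    with hE
  have hw : ∀ i, sectorGibbsWeightTT' β t t' U n L i = canonicalWeight β E (e i) := by
    intro i
    simp only [sectorGibbsWeightTT', canonicalWeight, sectorGibbsEnergyTT']
    congr 2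
    exact Equiv.sum_comp e (fun a => Real.exp (-(β * E a)))
  have hv : ∀ i, sectorGibbsVectorTT' t t' U n L i =
      sectorEigenvector (szConfig n L) (hubbardTorusTT' L t t' U) (hubbardTorusTT'_isHermitian L t t' U)
        (e i) := fun i => rfl
  simp_rw [hw, hv]
  rw [Equiv.sum_comp e (fun a => (canonicalWeight β E a : ℂ) *
    expect B (sectorEigenvector (szConfig n L) (hubbardTorusTT' L t t' U)
      (hubbardTorusTT'_isHermitian L t t' U) a))]
  exact sum_canonicalWeight_mul_expect_sectorEigenvector_eq_gibbsState (szConfig n L)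
    (hubbardTorusTT' L t t' U) (hubbardTorusTT'_isHermitian L t t' U) β B

/-! ### §2 Scale covariance in finite volume -/

/-- `H_L(ct, ct', cU)|_sector = c • H_L(t, t', U)|_sector` (the sector `(rectN n L, S^z = 0)` does not
depend on the couplings). [cite: XuEtAl2024, eq. (1)] -/
theorem sectorHamiltonianTT'_scale (c t t' U n : ℝ) (L : ℕ) :
    sectorHamiltonianTT' (c * t) (c * t') (c * U) n L = (c : ℂ) • sectorHamiltonianTT' t t' U n L := by
  unfold sectorHamiltonianTT'
  rw [hubbardTorusTT'_smul]
  rfl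

/-- **Canonical partition functions are scale-covariant**: `Z_β(H_L(ct,ct',cU)|_s) = Z_{βc}(H_L(t,t',U)|_s)`
(any real `c`; free energies, entropies, specific heats of the physical model are read off the unit model at
`βt`). [cite: Ruelle1969, §3.3] -/
theorem partitionFn_sectorHamiltonianTT'_scale (β c t t' U n : ℝ) (L : ℕ) :
    partitionFn β (sectorHamiltonianTT' (c * t) (c * t') (c * U) n L) =
      partitionFn (β * c) (sectorHamiltonianTT' t t' U n L) := by
  rw [sectorHamiltonianTT'_scale, Matrix.partitionFn_real_smul]

/-- The canonical sector Gibbs state of `H_L(ct,ct',cU)` at `β` is that of `H_L(t,t',U)` at `βc` (as linear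
functionals on sector operators; any real `c`). [cite: Ruelle1969, §3.3] -/
theorem gibbsState_sectorHamiltonianTT'_scale (β c t t' U n : ℝ) (L : ℕ) :
    gibbsState β (sectorHamiltonianTT' (c * t) (c * t') (c * U) n L) =
      gibbsState (β * c) (sectorHamiltonianTT' t t' U n L) := by
  rw [sectorHamiltonianTT'_scale, Matrix.gibbsState_real_smul]

/-- **The canonical sector Gibbs MIXTURE is scale-covariant on every torus operator**:
`Σ_i p_{L,i}(β; ct,ct',cU) ⟨ψ_{L,i}(ct,ct',cU), B ψ_{L,i}(ct,ct',cU)⟩ = Σ_i p_{L,i}(βc; t,t',U) ⟨ψ_{L,i}(t,t',U), B ψ_{L,i}(t,t',U)⟩`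
(any real `c`, any `B`). The two eigenbases need not coincide (Mathlib's choice); the STATES do.
[cite: Ruelle1969, §3.3] [cite: Israel1979, §I.3 eq. (26)] -/
theorem sum_sectorGibbsWeightTT'_mul_expect_scale (β c t t' U n : ℝ) (L : ℕ)
    (B : Matrix (Finset (Orb (FermionTorus 2 L))) (Finset (Orb (FermionTorus 2 L))) ℂ) :
    ∑ i, (sectorGibbsWeightTT' β (c * t) (c * t') (c * U) n L i : ℂ) *
        expect B (sectorGibbsVectorTT' (c * t) (c * t') (c * U) n L i) =
      ∑ i, (sectorGibbsWeightTT' (β * c) t t' U n L i : ℂ) *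
        expect B (sectorGibbsVectorTT' t t' U n L i) := by
  rw [sum_sectorGibbsWeightTT'_mul_expect_eq_gibbsState, sum_sectorGibbsWeightTT'_mul_expect_eq_gibbsState,
    gibbsState_sectorHamiltonianTT'_scale]

/-- The expectation in a transformed vector is the expectation of the conjugated operator:
`⟨Wψ, B Wψ⟩ = ⟨ψ, Wᴴ B W ψ⟩`. [folklore] -/
private theorem expect_mulVec_eq_expect_conj {κ : Type*} [LinearOrder κ] [Fintype κ]
    (B W : Matrix (Finset κ) (Finset κ) ℂ) (ψ : Fock κ) :
    expect B (W *ᵥ ψ) = expect (Wᴴ * B * W) ψ := by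
  unfold expect
  rw [star_mulVec, ← dotProduct_mulVec, mulVec_mulVec, mulVec_mulVec, Matrix.mul_assoc]

/-- **Scale covariance of the translation-averaged mixture expectations** (the terms of the torus-limit
predicate): for every region `Λ`, local observable `A` and side `L`,
`Σ_i p_{L,i}(β; cΦ) · torusAvgExpect L Λ A ψ_{L,i}(cΦ) = Σ_i p_{L,i}(βc; Φ) · torusAvgExpect L Λ A ψ_{L,i}(Φ)`.
[cite: Ruelle1969, §3.3] [cite: BratteliRobinsonI1987, §4.3.1 (PDF pp. 373–375)] -/
theorem sum_sectorGibbsWeightTT'_mul_torusAvgExpect_scale (β c t t' U n : ℝ) (L : ℕ)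
    (Λ : Finset (Site 2)) (A : FermionOp Λ) :
    ∑ i, (sectorGibbsWeightTT' β (c * t) (c * t') (c * U) n L i : ℂ) *
        torusAvgExpect L Λ A (sectorGibbsVectorTT' (c * t) (c * t') (c * U) n L i) =
      ∑ i, (sectorGibbsWeightTT' (β * c) t t' U n L i : ℂ) *
        torusAvgExpect L Λ A (sectorGibbsVectorTT' t t' U n L i) := by
  rcases Nat.eq_zero_or_pos L with hL | hL
  · subst hL
    simp only [torusAvgExpect_zero, mul_zero, Finset.sum_const_zero]
  haveI : NeZero L := ⟨hL.ne'⟩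
  simp_rw [torusAvgExpect_eq]
  by_cases hinj : Set.InjOn (Torus.proj (d := 2) L) ↑Λ
  · simp_rw [torusAvgExpectAt_of_injOn L hinj, Finset.mul_sum, expect_mulVec_eq_expect_conj]
    rw [Finset.sum_comm]
    conv_rhs => rw [Finset.sum_comm]
    refine Finset.sum_congr rfl fun v _ => ?_
    have h := sum_sectorGibbsWeightTT'_mul_expect_scale β c t t' U n L
      (((fockTranslate v).val)ᴴ * fermionEmbed (PolySite.toTorusEmb L hinj) A * (fockTranslate v).val)
    calc ∑ i, (sectorGibbsWeightTT' β (c * t) (c * t') (c * U) n L i : ℂ) *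
          (((Fintype.card (TorusSite 2 L) : ℂ))⁻¹ *
            expect (((fockTranslate v).val)ᴴ * fermionEmbed (PolySite.toTorusEmb L hinj) A *
              (fockTranslate v).val) (sectorGibbsVectorTT' (c * t) (c * t') (c * U) n L i))
        = ((Fintype.card (TorusSite 2 L) : ℂ))⁻¹ *
          ∑ i, (sectorGibbsWeightTT' β (c * t) (c * t') (c * U) n L i : ℂ) *
            expect (((fockTranslate v).val)ᴴ * fermionEmbed (PolySite.toTorusEmb L hinj) A *
              (fockTranslate v).val) (sectorGibbsVectorTT' (c * t) (c * t') (c * U) n L i) := by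
          rw [Finset.mul_sum]
          exact Finset.sum_congr rfl fun i _ => by ring
      _ = ((Fintype.card (TorusSite 2 L) : ℂ))⁻¹ *
          ∑ i, (sectorGibbsWeightTT' (β * c) t t' U n L i : ℂ) *
            expect (((fockTranslate v).val)ᴴ * fermionEmbed (PolySite.toTorusEmb L hinj) A *
              (fockTranslate v).val) (sectorGibbsVectorTT' t t' U n L i) := by rw [h]
      _ = _ := by
          rw [Finset.mul_sum]
          exact Finset.sum_congr rfl fun i _ => by ring
  · simp_rw [torusAvgExpectAt_of_not_injOn L hinj, mul_zero]

/-! ### §3 The torus-limit thermal states are scale-covariant -/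

namespace InfVolFermionState

/-- **THE THERMAL STATES OF `H(ct, ct', cU)` AT `β` ARE EXACTLY THOSE OF `H(t, t', U)` AT `βc`.**
In the torus-limit thermal convention (torus limits of the canonical sector Gibbs states on
`(rectN n L, S^z = 0)`), for every real `c`, every density `n` and every sequence of sides `Ls`:
`ω` is a thermal torus limit for the couplings `(ct, ct', cU)` at inverse temperature `β` iff it is one for
`(t, t', U)` at `βc` (the defining sequences coincide term by term,
`sum_sectorGibbsWeightTT'_mul_torusAvgExpect_scale`). [cite: Ruelle1969, §3.3]
[cite: BratteliRobinsonI1987, §4.3.1 (PDF pp. 373–375)] -/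
theorem isTorusLimitOfMixture_sectorGibbs_scale_iff (ω : InfVolFermionState 2) (β c t t' U n : ℝ)
    (Ls : ℕ → ℕ) :
    ω.IsTorusLimitOfMixture (sectorGibbsCount n)
        (fun L => sectorGibbsWeightTT' β (c * t) (c * t') (c * U) n L)
        (fun L => sectorGibbsVectorTT' (c * t) (c * t') (c * U) n L) Ls ↔
      ω.IsTorusLimitOfMixture (sectorGibbsCount n)
        (fun L => sectorGibbsWeightTT' (β * c) t t' U n L)
        (fun L => sectorGibbsVectorTT' t t' U n L) Ls := by
  simp only [InfVolFermionState.IsTorusLimitOfMixture, sum_sectorGibbsWeightTT'_mul_torusAvgExpect_scale]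

/-- **THE DIMENSIONLESS RESCALING LEMMA AT `T > 0` (unit form, torus-limit thermal convention).** For
`t ≠ 0`: `ω` is a thermal torus limit of the physical model `H(t, t', U)` at inverse temperature `β` iff
it is a thermal torus limit of the UNIT model `H(1, t'/t, U/t)` at `βt`. Hence every thermal word certified
at `t ≡ 1` as a function of `(t'/t, U/t, n, β̃)` holds for the physical model at `β = β̃/t`: thermal words
depend on `(U/t, t'/t, n, k_B T/t)` only and the kelvin axis of a phase map carries one power of `t_eV`.
[cite: Ruelle1969, §3.3] [cite: XuEtAl2024, eq. (1)] -/
theorem isTorusLimitOfMixture_sectorGibbs_iff_unit (ω : InfVolFermionState 2) (β : ℝ) {t : ℝ}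
    (ht : t ≠ 0) (t' U n : ℝ) (Ls : ℕ → ℕ) :
    ω.IsTorusLimitOfMixture (sectorGibbsCount n)
        (fun L => sectorGibbsWeightTT' β t t' U n L)
        (fun L => sectorGibbsVectorTT' t t' U n L) Ls ↔
      ω.IsTorusLimitOfMixture (sectorGibbsCount n)
        (fun L => sectorGibbsWeightTT' (β * t) 1 (t' / t) (U / t) n L)
        (fun L => sectorGibbsVectorTT' 1 (t' / t) (U / t) n L) Ls := by
  simpa only [mul_one, mul_div_cancel₀ _ ht] using
    isTorusLimitOfMixture_sectorGibbs_scale_iff ω β t 1 (t' / t) (U / t) n Ls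


end InfVolFermionState

/-- **Free-energy rows are scale-covariant**: the canonical partition function of the physical model
`H_L(t, ts, tu)|_sector` at `β` is that of the unit model `H_L(1, s, u)|_sector` at `βt` (so a certified
row `ℓ·L² ≤ log Z_{L,β̃}` / `log Z_{L,β̃} ≤ u·L²` of the unit model at `β̃ = βt` is the same row for the
physical model at `β`, and the chords of `TorusSectorGibbsEnergyWindow` read in physical units carry one
power of `t`). [cite: Ruelle1969, §3.3] -/
theorem partitionFn_sectorHamiltonianTT'_phys_eq_unit (β t s u n : ℝ) (L : ℕ) :
    partitionFn β (sectorHamiltonianTT' t (t * s) (t * u) n L) =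
      partitionFn (β * t) (sectorHamiltonianTT' 1 s u n L) := by
  have h := partitionFn_sectorHamiltonianTT'_scale β t 1 s u n L
  rwa [mul_one] at h

end Literature.MathematicalPhysics.QuantumLattice

end
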